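import Literature.Geometry.GeometricMeasureTheory.CubicalPolyhedral
import Literature.Geometry.GeometricMeasureTheory.LevelSetChartCurrent
import Literature.Geometry.GeometricMeasureTheory.RectifiableGluing
import Literature.Geometry.GeometricMeasureTheory.CurrentsRestrict
import Literature.Geometry.GeometricMeasureTheory.RectifiableDataRestrict
import Literature.Geometry.GeometricMeasureTheory.CurrentsSupportLocal
import Literature.Geometry.GeometricMeasureTheory.LowerDensityBound
import Literature.Analysis.Calculus.SardProofs
import HarnessLib

/-!
# Sphere slices of integral polyhedral cycles are rectifiable currents

A brick of B. White's structure-theorem-free proof of the closure theorem for integral currents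
[White1989] (the induction step slices the approximating currents by spheres and needs the slices
to be integral cycles of one dimension less; after the deformation theorem
`Current.IsRectifiable.exists_deformation_of_cycle` the approximants are integral polyhedral
cycles of a cubical subdivision). Federer's "`⟨T, u, r+⟩ ∈ 𝓡_{m-1}` for `ℒ¹` almost all `r`"
[Federer1969, 4.2.1, 4.3.8] is proved here for this flat class:

for `P ∈ 𝓡_{k+1}(V)` with `∂P = 0` and `spt P ⊆ μ_ε W'_{k+1}` (the scaled `(k+1)`-skeleton of
`CubicalModel.lean`) and a centre `x ∈ V`, for almost every radius `r > 0` the boundary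
`∂(P ⌞ 𝐁(x, r))` of the piece of `P` in the ball is a rectifiable `k`-current
(`Current.IsRectifiable.ae_isRectifiable_boundary_restrictSet_closedBall`).

Architecture (that of `Literature/Geometry/Kaehler/HolomorphicChainSliceRectifiable.lean`, with the
regular part of a holomorphic chain replaced by the open top faces and the singular locus by the
lower skeleton `μ_ε W'_k`):

* `Current.IsRectifiable.exists_int_restrictSet_ballV_eq` — on the neighbourhood `ballV z` of a
  `(k+1)`-face the cycle is `a_z ⟦μ_ε W'(z)⟧`, `a_z ∈ ℤ` (constancy theorem
  `Current.IsRectifiable.exists_int_restrictSet_eq_face` [Federer1969, 4.1.31, 4.2.9]).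
* `Current.IsRectifiable.exists_polyhedral_sliceData` — near a point of a top face and off a null
  set of levels (Sard, along the isometric affine chart of the face), `∂(P ⌞ B(x, √(-s)))` is the
  current of integration over the level set of the chart with admissible data: the area formula
  with Jacobian `1` turns `a_z ∫_{μ_ε W'(z) ∩ B} dφ(e_z) d𝓗^{k+1}` into the left-hand side of the
  local Gauss–Green identity `exists_levelSet_chartData` (`LevelSetChartCurrent.lean`).
* `Current.IsRectifiable.exists_isRectifiableData_polyhedral_slice_eq` — the local data glue on
  `U = V ∖ μ_ε W'_k` (`Current.exists_isRectifiableData_of_locally`); off the slice carrier the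
  boundary vanishes locally (inside the ball it is `∂P = 0`).
* `Cubical.ae_euclideanHausdorffMeasure_skeletonV_inter_levelSet_eq_zero` — the lower skeleton
  meets almost every sphere in an `𝓗ᵏ`-null set.
* `Current.IsRectifiable.ae_isRectifiable_boundary_restrictSet_ball_sqrt`, `…_closedBall` — the
  glued multiplicity is summable by the mass formula and the a.e. finite slice mass
  (`Current.ae_mass_boundary_piece_le_deriv`), so the data are admissible on the whole space, and
  `-[slice] + ∂(P ⌞ B)` is an integral flat chain supported in the null set `μ_ε W'_k ∩ S(x, r)`,
  hence zero by the support theorem `Current.add_boundary_eq_zero_of_isLocallyRectifiable`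
  [Federer1969, 4.1.20] (`k ≥ 1`; for `k = 0` its support is empty); closed and open balls give
  the same piece off the countably many `‖P‖`-charged spheres.

Theorems only; no definitions, no named facts.

## References

* H. Federer, *Geometric Measure Theory*, Springer 1969, 4.1.20, 4.1.28, 4.1.31, 4.2.1, 4.2.9,
  4.3.8 [Federer1969].
* B. White, *A new proof of the compactness theorem for integral currents*, Comment. Math. Helv.
  64 (1989) 207–220, p. 212 (slicing in the induction step) [White1989].
-/

noncomputable section

open scoped Distributions ENNReal NNReal Topology ContDiff InnerProductSpace RealInnerProductSpace
open MeasureTheory TopologicalSpace Set Filter Metric Function Module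

namespace Literature.Geometry.GeometricMeasureTheory

-- Nested operator-norm instances on (duals of) `V [⋀^Fin m]→L[ℝ] ℝ`, as in `Currents.lean`.
set_option maxSynthPendingDepth 2

/-! ### Plumbing -/

section Plumbing

variable {E : Type*} [NormedAddCommGroup E] [NormedSpace ℝ E] [FiniteDimensional ℝ E]
  [MeasurableSpace E] [BorelSpace E] {Ω Ω' : Opens E} {m : ℕ}

/-- `(T ⌞ A)(φ) = (T ⌞ (A ∩ B))(φ)` when `φ` is supported in `B`: `1_A φ = 1_{A ∩ B} φ`.
[cite: Federer1969, 4.1.7] -/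
theorem Current.IsRepresentable.restrictSet_apply_eq_restrictSet_inter_apply {T : Current Ω m}
    (hT : T.IsRepresentable) {A B : Set E} (hA : MeasurableSet A) (hB : MeasurableSet B)
    {φ : TestForm Ω m} (h : Function.support ⇑φ ⊆ B) :
    hT.restrictSet A hA φ = hT.restrictSet (A ∩ B) (hA.inter hB) φ := by
  rw [hT.restrictSet_apply, hT.restrictSet_apply]
  have : ((hT.integrable_testForm φ).indicator hA).toL1 (A.indicator ⇑φ) =
      ((hT.integrable_testForm φ).indicator (hA.inter hB)).toL1 ((A ∩ B).indicator ⇑φ) := by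
    refine Integrable.toL1_congr_eq _ _ (funext fun x => ?_)
    by_cases hxA : x ∈ A
    · by_cases hxB : x ∈ B
      · rw [indicator_of_mem hxA, indicator_of_mem (mem_inter hxA hxB)]
      · rw [indicator_of_mem hxA, indicator_of_notMem (fun h' => hxB h'.2)]
        exact notMem_support.1 fun h' => hxB (h h')
    · rw [indicator_of_notMem hxA, indicator_of_notMem (fun h' => hxA h'.1)]
  rw [this]

/-- Restrictions of equal currents through two representability witnesses agree.
[cite: Federer1969, 4.1.7] -/
theorem Current.IsRepresentable.restrictSet_congr_current {T₁ T₂ : Current Ω m} (h : T₁ = T₂)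
    (h₁ : T₁.IsRepresentable) (h₂ : T₂.IsRepresentable) {A : Set E} (hA : MeasurableSet A) :
    h₁.restrictSet A hA = h₂.restrictSet A hA := by
  subst h; rfl

omit [FiniteDimensional ℝ E] [MeasurableSpace E] [BorelSpace E] in
/-- `𝐌(X|Ω') ≤ 𝐌(X)` for the restriction of a current to a smaller open set.
[cite: Federer1969, 4.1.7] -/
private theorem Current.mass_comp_monoCLM_le' (hle : Ω' ≤ Ω) (X : Current Ω m) :
    Current.mass (X.comp (TestFunction.monoCLM ℝ) : Current Ω' m) ≤ X.mass := by
  refine iSup₂_le fun ψ hψ => ?_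
  rw [ContinuousLinearMap.comp_apply]
  exact X.ofReal_apply_le_mass fun x => by rw [TestForm.monoCLM_apply_of_le hle]; exact hψ x

end Plumbing

section Data

variable {V : Type*} [NormedAddCommGroup V] [InnerProductSpace ℝ V] [FiniteDimensional ℝ V]
  [MeasurableSpace V] [BorelSpace V] {Ω Ω' : Opens V} {m : ℕ}

omit [FiniteDimensional ℝ V] [MeasurableSpace V] [BorelSpace V] in
/-- Pulling an integer constant out of a density. [folklore] -/
private theorem intCast_mul_smul_frameVector_eq' (θ : V → ℤ) (ξ : V → Fin m → V) (c : ℤ) :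
    (fun x => (((c * θ x : ℤ)) : ℝ) • frameVector (ξ x)) =
      fun x => (c : ℝ) • ((θ x : ℝ) • frameVector (ξ x)) := by
  funext x
  rw [Int.cast_mul, mul_smul]

omit [FiniteDimensional ℝ V] in
/-- `[W, c θ, ξ](φ) = c · [W, θ, ξ](φ)` for an integer constant `c` and locally summable data.
[cite: Federer1969, 4.1.7] -/
private theorem currentOfIntegration_const_mul_apply' {W : Set V} {θ : V → ℤ} {ξ : V → Fin m → V}
    (h : LocallyIntegrableOn (fun x => (θ x : ℝ) • frameVector (ξ x)) (Ω : Set V)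
      ((μHE[m] : Measure V).restrict W)) (c : ℤ) (φ : TestForm Ω m) :
    (currentOfIntegration W (fun x => c * θ x) ξ : Current Ω m) φ =
      (c : ℝ) * currentOfIntegration W θ ξ φ := by
  have hc : LocallyIntegrableOn (fun x => (((c * θ x : ℤ)) : ℝ) • frameVector (ξ x)) (Ω : Set V)
      ((μHE[m] : Measure V).restrict W) := by
    rw [intCast_mul_smul_frameVector_eq']
    exact h.smul (c : ℝ)
  rw [currentOfIntegration_apply hc, currentOfIntegration_apply h, ← integral_const_mul]
  refine integral_congr_ae (Eventually.of_forall fun x => ?_)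
  simp only [Int.cast_mul, mul_assoc]

omit [FiniteDimensional ℝ V] in
/-- Admissible data stay admissible when the multiplicity is multiplied by an integer constant.
[cite: Federer1969, 4.1.28 (4)] -/
private theorem IsRectifiableData.const_mul' {W : Set V} {θ : V → ℤ} {ξ : V → Fin m → V}
    (h : IsRectifiableData Ω m W θ ξ) (c : ℤ) : IsRectifiableData Ω m W (fun x => c * θ x) ξ := by
  obtain ⟨h1, h2, h3, h4, h5⟩ := h
  refine ⟨h1, h2, h3, ?_, h5⟩
  rw [intCast_mul_smul_frameVector_eq']
  exact h4.smul (c : ℝ)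

/-- Admissible data with summable multiplicity are admissible on every open set containing the
carrier. [cite: Federer1969, 4.1.28 (4), (5)] -/
private theorem IsRectifiableData.of_lintegral_lt_top' {W : Set V} {θ : V → ℤ} {ξ : V → Fin m → V}
    (h : IsRectifiableData Ω m W θ ξ)
    (hfin : ∫⁻ x in W, ‖(θ x : ℝ)‖ₑ ∂(μHE[m] : Measure V) < ⊤) (hW : W ⊆ (Ω' : Set V)) :
    IsRectifiableData Ω' m W θ ξ := by
  obtain ⟨hWm, hWΩ, hrect, hint, hae⟩ := h
  refine ⟨hWm, hW, hrect, ?_, hae⟩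
  have hmeas : AEStronglyMeasurable (fun x => (θ x : ℝ) • frameVector (ξ x))
      ((μHE[m] : Measure V).restrict W) := by
    have h1 := hint.aestronglyMeasurable
    rwa [Measure.restrict_restrict Ω.isOpen.measurableSet, inter_eq_right.2 hWΩ] at h1
  have hI : Integrable (fun x => (θ x : ℝ) • frameVector (ξ x)) ((μHE[m] : Measure V).restrict W) := by
    refine ⟨hmeas, ?_⟩
    show ∫⁻ x, ‖(θ x : ℝ) • frameVector (ξ x)‖ₑ ∂((μHE[m] : Measure V).restrict W) < ⊤
    calc ∫⁻ x, ‖(θ x : ℝ) • frameVector (ξ x)‖ₑ ∂((μHE[m] : Measure V).restrict W)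
        = ∫⁻ x, ‖(θ x : ℝ)‖ₑ ∂((μHE[m] : Measure V).restrict W) := by
          refine lintegral_congr_ae ?_
          filter_upwards [hae] with x hx
          rw [enorm_smul, ← ofReal_norm (frameVector (ξ x)), norm_frameVector_eq_one hx.1,
            ENNReal.ofReal_one, mul_one]
      _ < ⊤ := hfin
  exact hI.locallyIntegrable.locallyIntegrableOn _

end Data

/-! ### The polyhedral cycle near a top face: constancy -/

section Polyhedral

open Cubical

variable {V : Type*} [NormedAddCommGroup V] [InnerProductSpace ℝ V] [FiniteDimensional ℝ V]
  [MeasurableSpace V] [BorelSpace V] {n : ℕ}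

/-- **A rectifiable cycle carried by the `(k+1)`-skeleton is a constant integral multiple of the
face on each face neighbourhood**: `P ⌞ ballV z = a_z ⟦μ_ε W'(z)⟧` for every `(k+1)`-face `z`
(Federer's constancy step in 4.2.9; `a_z = 0` is allowed). [cite: Federer1969, 4.1.31, 4.2.9] -/
theorem Current.IsRectifiable.exists_int_restrictSet_ballV_eq (b : OrthonormalBasis (Fin n) ℝ V)
    {k : ℕ} {ε : ℝ} (hε : 0 < ε) {P : Current (⊤ : Opens V) (k + 1)} (hP : P.IsRectifiable)
    (hPr : P.IsRepresentable) (hcyc : P.boundary = 0) (hsupp : P.support ⊆ skeletonV b (k + 1) ε)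
    {z : Fin n → ℤ} (hz : faceDim z = k + 1) :
    ∃ a : ℤ, hPr.restrictSet (ballV b ε z) (isOpen_ballV b z).measurableSet =
      currentOfIntegration (faceV b ε z) (fun _ => a) (fun _ => faceFrame b z hz) := by
  obtain ⟨a, ha⟩ := hP.exists_int_restrictSet_eq_face hPr (faceDirV b z) (faceCenter b ε z)
    ((finrank_faceDirV b z).trans hz) (orthonormal_faceFrame b z hz) (faceFrame_mem b z hz)
    (isOpen_ballV b z)
    (by rw [ballV_inter_plane_eq_faceV b hε]; exact (convex_faceV b hε.ne' z).isPreconnected)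
    (by rw [ballV_inter_plane_eq_faceV b hε]; exact (euclideanHausdorffMeasure_faceV_lt_top b hε hz).ne)
    (fun x hx => faceV_subset_plane b z
      ((ballV_inter_skeletonV_eq_faceV b (ε := ε) hz).subset ⟨hx.2, hsupp hx.1⟩))
    (fun φ _ => by rw [hcyc]; rfl)
  exact ⟨a, by rw [ha, ballV_inter_plane_eq_faceV b hε]⟩


/-! ### The slice near a point of a top face -/

/-- **Sphere slices of a polyhedral cycle near a point of a top face.** Let `P ∈ 𝓡_{k+1}(V)` be a
cycle carried by the scaled `(k+1)`-skeleton `μ_ε W'_{k+1}`, `x ∈ V`, `f = -‖· - x‖²` (so that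
`{s < f} = B(x, √(-s))`) and `z` a `(k+1)`-face. There is a Lebesgue-null set `Bad` of levels (the
critical values of `f` along the affine chart of the face; Sard) such that for every level
`s ∉ Bad` and every point `p ∈ μ_ε W'(z)` with `f p = s` there are an open `O ∋ p` and admissible
rectifiable data `(M_s ∩ O, θ, ν)` on the whole space,
`M_s = f⁻¹{s} ∩ (μ_ε W'_{k+1} ∖ μ_ε W'_k)`, with
`∂(P ⌞ {s < f})(φ) = [M_s ∩ O, θ, ν](φ)` for all test forms `φ` supported in `O`, on every open
set `U`. On `ballV z` the cycle is `a_z ⟦μ_ε W'(z)⟧` (constancy), so for such `φ`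
`∂(P ⌞ {s<f})(φ) = a_z ∫_{μ_ε W'(z) ∩ {s<f}} dφ(e_z) d𝓗^{k+1} = a_z ∫_{O₁ ∩ {s < G}} (Ψ^* dφ)(e) du`
along the isometric chart `Ψ` of the plane of the face (area formula with Jacobian `1`), which is
the level-set current of the chart at the regular level `s` (`exists_levelSet_chartData`).
[cite: Federer1969, 4.3.8, 4.2.1, 4.1.31] -/
theorem Current.IsRectifiable.exists_polyhedral_sliceData (b : OrthonormalBasis (Fin n) ℝ V)
    {k : ℕ} {ε : ℝ} (hε : 0 < ε) {P : Current (⊤ : Opens V) (k + 1)} (hP : P.IsRectifiable)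
    (hPr : P.IsRepresentable) (hcyc : P.boundary = 0) (hsupp : P.support ⊆ skeletonV b (k + 1) ε)
    (x : V) {z : Fin n → ℤ} (hz : faceDim z = k + 1) :
    ∃ Bad : Set ℝ, volume Bad = 0 ∧ ∀ s ∉ Bad, ∀ p ∈ faceV b ε z, -‖p - x‖ ^ 2 = s →
      ∃ O : Set V, IsOpen O ∧ p ∈ O ∧ ∃ (θ : V → ℤ) (ν : V → Fin k → V),
        IsRectifiableData (⊤ : Opens V) k
          ((fun y : V => -‖y - x‖ ^ 2) ⁻¹' {s} ∩ (skeletonV b (k + 1) ε \ skeletonV b k ε) ∩ O) θ ν ∧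
        ∀ (U : Opens V) (φ : TestForm U k), tsupport ⇑φ ⊆ O →
          ((hPr.restrictSet (ball x (Real.sqrt (-s))) measurableSet_ball).boundary.comp
            (TestFunction.monoCLM ℝ) : Current U k) φ =
          currentOfIntegration
            ((fun y : V => -‖y - x‖ ^ 2) ⁻¹' {s} ∩ (skeletonV b (k + 1) ε \ skeletonV b k ε) ∩ O)
            θ ν φ := by
  classical
  set f : V → ℝ := fun y => -‖y - x‖ ^ 2 with hfdef
  have hfs : ContDiff ℝ ∞ f := ((contDiff_norm_sq ℝ).comp (contDiff_id.sub contDiff_const)).neg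
  set M : ℝ → Set V := fun s => f ⁻¹' {s} ∩ (skeletonV b (k + 1) ε \ skeletonV b k ε) with hMdef
  -- the face, its plane `c + K`, the frame
  set c : V := faceCenter b ε z with hc
  set K : Submodule ℝ V := faceDirV b z with hKdef
  have hK : Module.finrank ℝ K = k + 1 := (finrank_faceDirV b z).trans hz
  set ff : Fin (k + 1) → V := faceFrame b z hz with hff
  have hffon : Orthonormal ℝ ff := orthonormal_faceFrame b z hz
  have hbVface : ballV b ε z ∩ skeletonV b (k + 1) ε = faceV b ε z :=
    ballV_inter_skeletonV_eq_faceV b (ε := ε) hz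
  have hbVlow : ballV b ε z ∩ skeletonV b k ε = ∅ :=
    ballV_inter_skeletonV_eq_empty b (ε := ε) (show k < faceDim z by omega)
  have hplane : ballV b ε z ∩ {y | y - c ∈ K} = faceV b ε z := ballV_inter_plane_eq_faceV b hε z
  have hfaceplane : faceV b ε z ⊆ {y | y - c ∈ K} := faceV_subset_plane b z
  have hfacebV : faceV b ε z ⊆ ballV b ε z := fun y hy => (hbVface.symm.subset hy).1
  -- constancy on `ballV z`
  obtain ⟨a, ha⟩ := hP.exists_int_restrictSet_ballV_eq b hε hPr hcyc hsupp hz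
  -- an orthonormal basis of `K` from the face frame, the isometry `Lc : K ≃ ℝ^{k+1}`
  set eK : Fin (k + 1) → K := fun j => ⟨ff j, faceFrame_mem b z hz j⟩ with heK
  have hon : Orthonormal ℝ eK := by
    rw [orthonormal_iff_ite] at hffon ⊢
    intro i j
    rw [Submodule.coe_inner]
    exact hffon i j
  have hsp : ⊤ ≤ Submodule.span ℝ (Set.range eK) :=
    (hon.linearIndependent.span_eq_top_of_card_eq_finrank' (by rw [Fintype.card_fin, hK])).ge
  set Eb : OrthonormalBasis (Fin (k + 1)) ℝ K := OrthonormalBasis.mk hon hsp with hEb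
  have hEbj : ∀ j, (Eb j : V) = ff j := fun j => by
    rw [hEb, OrthonormalBasis.coe_mk]
  set Lc : K ≃L[ℝ] (Fin (k + 1) → ℝ) :=
    Eb.repr.toContinuousLinearEquiv.trans
      (PiLp.continuousLinearEquiv 2 ℝ (fun _ : Fin (k + 1) => ℝ)) with hLc
  have hLce : ∀ j, Lc.symm (Pi.single j 1) = eK j := fun j => by
    show Eb.repr.symm (EuclideanSpace.single j 1) = _
    rw [Eb.repr_symm_single, hEb, OrthonormalBasis.coe_mk]
  have hLccoe : (⇑Lc : K → (Fin (k + 1) → ℝ)) =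
      (@WithLp.ofLp 2 (Fin (k + 1) → ℝ)) ∘ ⇑Eb.repr := by
    funext y; rfl
  have hLcmp : MeasurePreserving (⇑Lc) (volume : Measure K)
      (volume : Measure (Fin (k + 1) → ℝ)) := by
    rw [hLccoe]
    exact (PiLp.volume_preserving_ofLp (Fin (k + 1))).comp Eb.measurePreserving_repr
  have hLcemb : MeasurableEmbedding (⇑Lc) := Lc.toHomeomorph.measurableEmbedding
  -- the affine chart `Ψ₀ : K → V`, `Ψ = Ψ₀ ∘ Lc⁻¹`
  set Ψ₀ : K → V := fun y => c + (y : V) with hΨ₀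
  set D : K →L[ℝ] V := K.subtypeL with hD
  have hΨ₀D : ∀ y, HasFDerivAt Ψ₀ D y := fun y => (K.subtypeL.hasFDerivAt).const_add c
  have hDinj : Injective D := fun y y' h => Subtype.ext h
  have hnormDet : ((D : K →L[ℝ] V) : K →ₗ[ℝ] V).normDet = 1 := by
    rw [hD, Submodule.toLinearMap_subtypeL, ← Submodule.subtypeₗᵢ_toLinearMap]
    exact K.subtypeₗᵢ.normDet_eq_one
  have hΨ₀inj : Injective Ψ₀ := fun y y' h => Subtype.ext (add_left_cancel h)
  have hΨ₀plane : ∀ y, Ψ₀ y ∈ {w : V | w - c ∈ K} := fun y => by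
    show c + (y : V) - c ∈ K
    rw [add_sub_cancel_left]; exact y.2
  have hΨ₀cont : Continuous Ψ₀ := continuous_const.add continuous_subtype_val
  set Ψ : (Fin (k + 1) → ℝ) → V := fun u => Ψ₀ (Lc.symm u) with hΨdef
  have hΨcont : Continuous Ψ := hΨ₀cont.comp Lc.symm.continuous
  have hΨD : ∀ u, HasFDerivAt Ψ (D.comp (Lc.symm : (Fin (k + 1) → ℝ) →L[ℝ] K)) u := fun u =>
    (hΨ₀D (Lc.symm u)).comp u Lc.symm.hasFDerivAt
  have hΨfd : ∀ u, fderiv ℝ Ψ u = D.comp (Lc.symm : (Fin (k + 1) → ℝ) →L[ℝ] K) := fun u =>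
    (hΨD u).fderiv
  have hΨsmooth : ContDiff ℝ ∞ Ψ :=
    (contDiff_const.add K.subtypeL.contDiff).comp Lc.symm.contDiff
  have hΨinj : ∀ u, Injective (fderiv ℝ Ψ u) := fun u => by
    rw [hΨfd u]; exact hDinj.comp Lc.symm.injective
  have hΨframe : ∀ u j, fderiv ℝ Ψ u (Pi.single j 1) = ff j := fun u j => by
    rw [hΨfd u, ContinuousLinearMap.comp_apply, ContinuousLinearEquiv.coe_coe, hLce j]
    rfl
  -- the left inverse `ℓ`
  set π : V →L[ℝ] K := K.orthogonalProjectionOnto with hπ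
  set ℓ : V → (Fin (k + 1) → ℝ) := fun y => Lc (π (y - c)) with hℓdef
  have hsub1 : LipschitzWith 1 (fun y : V => y - c) :=
    LipschitzWith.mk_one fun y y' => le_of_eq (by rw [dist_eq_norm, dist_eq_norm, sub_sub_sub_cancel_right])
  have hℓ : LipschitzWith (‖(Lc : K →L[ℝ] (Fin (k + 1) → ℝ))‖₊ * (‖π‖₊ * 1)) ℓ :=
    (Lc : K →L[ℝ] (Fin (k + 1) → ℝ)).lipschitz.comp (π.lipschitz.comp hsub1)
  have hℓΨ₀ : ∀ y : K, ℓ (Ψ₀ y) = Lc y := fun y => by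
    show Lc (π (c + (y : V) - c)) = Lc y
    rw [add_sub_cancel_left, hπ, Submodule.orthogonalProjectionOnto_mem_subspace_eq_self]
  have hℓΨ : ∀ u, ℓ (Ψ u) = u := fun u => by
    show ℓ (Ψ₀ (Lc.symm u)) = u
    rw [hℓΨ₀, ContinuousLinearEquiv.apply_symm_apply]
  -- the chart domain `O₀ = Ψ⁻¹(ballV z)` and `G = f ∘ Ψ`
  set O₀ : Set (Fin (k + 1) → ℝ) := {u | Ψ u ∈ ballV b ε z} with hO₀
  have hO₀o : IsOpen O₀ := (isOpen_ballV b z).preimage hΨcont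
  have hΨO₀ : ∀ u ∈ O₀, Ψ u ∈ faceV b ε z := fun u hu =>
    hplane.subset ⟨hu, hΨ₀plane _⟩
  set G : (Fin (k + 1) → ℝ) → ℝ := fun u => f (Ψ u) with hGdef
  have hGs : ContDiff ℝ ∞ G := hfs.comp hΨsmooth
  -- Sard: the critical values of `G` on `O₀` are null
  set Bad : Set ℝ := G '' {u | u ∈ O₀ ∧ ¬ Surjective (fderiv ℝ G u)} with hBad
  have hBad0 : volume Bad = 0 :=
    Literature.Analysis.Calculus.measure_image_setOf_not_surjective_fderiv_eq_zero volume hO₀o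
      hGs.contDiffOn
  refine ⟨Bad, hBad0, fun s hs p hp hfp => ?_⟩
  -- the point `p = Ψ u₀` and the regular level `s`
  have hpK : p - c ∈ K := hfaceplane hp
  set y₀ : K := ⟨p - c, hpK⟩ with hy₀
  have hΨ₀y₀ : Ψ₀ y₀ = p := by show c + (p - c) = p; abel
  set u₀ : Fin (k + 1) → ℝ := Lc y₀ with hu₀
  have hΨu₀ : Ψ u₀ = p := by
    show Ψ₀ (Lc.symm (Lc y₀)) = p
    rw [ContinuousLinearEquiv.symm_apply_apply, hΨ₀y₀]
  have hu₀O₀ : u₀ ∈ O₀ := by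
    show Ψ u₀ ∈ ballV b ε z
    rw [hΨu₀]; exact hfacebV hp
  have hGu₀ : G u₀ = s := by show f (Ψ u₀) = s; rw [hΨu₀]; exact hfp
  have hdG : fderiv ℝ G u₀ ≠ 0 := fun h0 => hs ⟨u₀, ⟨hu₀O₀, fun hsj => by
    obtain ⟨v, hv⟩ := hsj 1
    rw [h0] at hv
    simp at hv⟩, hGu₀⟩
  -- the level-set current of the chart near `u₀`
  obtain ⟨O₁, hO₁o, hu₀O₁, hO₁O₀, hlev⟩ :=
    exists_levelSet_chartData hO₀o hΨsmooth.contDiffOn (fun u _ => hΨinj u) hℓ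
      (fun u _ => hℓΨ u) hGs.contDiffOn hu₀O₀ hdG
  obtain ⟨θ, ν, hdata, hident⟩ := hlev s
  set O : Set V := ballV b ε z ∩ ℓ ⁻¹' O₁ with hOdef
  have hOo : IsOpen O := (isOpen_ballV b z).inter (hO₁o.preimage hℓ.continuous)
  have hpO : p ∈ O := by
    refine ⟨hfacebV hp, ?_⟩
    show ℓ p ∈ O₁
    rw [← hΨu₀, hℓΨ]; exact hu₀O₁
  -- the slice carrier near `p` is the level set of the chart
  have hMO : M s ∩ O = Ψ '' (O₁ ∩ G ⁻¹' {s}) := by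
    apply Subset.antisymm
    · rintro y ⟨⟨hys, hyk1, hyk⟩, hybV, hyO₁⟩
      have hyface : y ∈ faceV b ε z := hbVface.subset ⟨hybV, hyk1⟩
      have hyK : y - c ∈ K := hfaceplane hyface
      have hyΨ : Ψ (ℓ y) = y := by
        have h1 : ℓ y = Lc ⟨y - c, hyK⟩ := by
          have := hℓΨ₀ ⟨y - c, hyK⟩
          rwa [show Ψ₀ ⟨y - c, hyK⟩ = y from by show c + (y - c) = y; abel] at this
        rw [h1]
        show Ψ₀ (Lc.symm (Lc ⟨y - c, hyK⟩)) = y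
        rw [ContinuousLinearEquiv.symm_apply_apply]
        show c + (y - c) = y; abel
      refine ⟨ℓ y, ⟨hyO₁, ?_⟩, hyΨ⟩
      show G (ℓ y) ∈ ({s} : Set ℝ)
      show f (Ψ (ℓ y)) ∈ ({s} : Set ℝ)
      rw [hyΨ]; exact hys
    · rintro _ ⟨u, ⟨huO₁, hus⟩, rfl⟩
      have huO₀ : u ∈ O₀ := hO₁O₀ huO₁
      have hface : Ψ u ∈ faceV b ε z := hΨO₀ u huO₀
      refine ⟨⟨hus, faceV_subset_skeletonV b z hface |> fun h => by rwa [hz] at h, fun hlow => ?_⟩,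
        huO₀, ?_⟩
      · exact (hbVlow.subset ⟨huO₀, hlow⟩).elim
      · show ℓ (Ψ u) ∈ O₁
        rw [hℓΨ u]; exact huO₁
  have hdata' : IsRectifiableData (⊤ : Opens V) k (Ψ '' (O₁ ∩ G ⁻¹' {s})) θ ν :=
    hdata ⊤ (by simp)
  refine ⟨O, hOo, hpO, fun y => a * θ y, ν, ?_, fun U φ hφO => ?_⟩
  · show IsRectifiableData (⊤ : Opens V) k (M s ∩ O) (fun y => a * θ y) ν
    rw [hMO]
    exact hdata'.const_mul' a
  -- the identity for `φ` supported in `O`, on `U`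
  show ((hPr.restrictSet (ball x (Real.sqrt (-s))) measurableSet_ball).boundary.comp
      (TestFunction.monoCLM ℝ) : Current U k) φ = currentOfIntegration (M s ∩ O) (fun y => a * θ y) ν φ
  have hleU : U ≤ (⊤ : Opens V) := le_top
  set E' : Set V := ball x (Real.sqrt (-s)) with hE'
  have hE'm : MeasurableSet E' := measurableSet_ball
  have hE'eq : ∀ y, y ∈ E' ↔ s < f y := fun y => by
    rw [hE', mem_ball, dist_eq_norm, Real.lt_sqrt (norm_nonneg _)]
    show _ ↔ s < -‖y - x‖ ^ 2
    constructor <;> intro h <;> linarith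
  set χ : TestForm (⊤ : Opens V) (k + 1) := TestForm.extDerivCLM (TestFunction.monoCLM ℝ φ) with hχ
  have hχcoe : ⇑χ = extDeriv ⇑φ := by
    rw [hχ, TestForm.extDerivCLM_apply, TestForm.monoCLM_apply_of_le hleU]
  have hχsupp : tsupport ⇑χ ⊆ O := by
    refine (TestForm.tsupport_extDerivCLM_subset _).trans ?_
    rw [TestForm.monoCLM_apply_of_le hleU]; exact hφO
  have h0 : ((hPr.restrictSet E' hE'm).boundary.comp (TestFunction.monoCLM ℝ) : Current U k) φ =
      hPr.restrictSet E' hE'm χ := rfl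
  -- (1) localise to `ballV z`
  have hbVm : MeasurableSet (ballV b ε z) := (isOpen_ballV b z).measurableSet
  have h1 : hPr.restrictSet E' hE'm χ = hPr.restrictSet (E' ∩ ballV b ε z) (hE'm.inter hbVm) χ :=
    hPr.restrictSet_apply_eq_restrictSet_inter_apply hE'm hbVm
      ((subset_tsupport _).trans (hχsupp.trans inter_subset_left))
  -- (2) the cut current near the face is `a ⟦μ_ε W'(z) ∩ E'⟧`
  obtain ⟨⟨W₀, θ₀, ξ₀, hd, rfl⟩, hcpt⟩ := hP
  have hfinμ : (μHE[k + 1] : Measure V) (faceV b ε z) < ⊤ := euclideanHausdorffMeasure_faceV_lt_top b hε hz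
  haveI : IsFiniteMeasure ((μHE[k + 1] : Measure V).restrict (faceV b ε z)) :=
    ⟨by rw [Measure.restrict_apply_univ]; exact hfinμ⟩
  have hconst : LocallyIntegrableOn (fun _ : V => ((a : ℤ) : ℝ) • frameVector ff)
      ((⊤ : Opens V) : Set V) ((μHE[k + 1] : Measure V).restrict (faceV b ε z)) :=
    (integrable_const _).locallyIntegrable.locallyIntegrableOn _
  have h2 : hPr.restrictSet (E' ∩ ballV b ε z) (hE'm.inter hbVm) =
      (currentOfIntegration (faceV b ε z ∩ E') (fun _ => a) (fun _ => ff) : Current (⊤ : Opens V) (k + 1)) := by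
    have h2a : hPr.restrictSet (E' ∩ ballV b ε z) (hE'm.inter hbVm) =
        currentOfIntegration (W₀ ∩ (E' ∩ ballV b ε z)) θ₀ ξ₀ := hd.restrictSet_eq _
    have h2b : (hd.inter hbVm).isRepresentable.restrictSet E' hE'm =
        currentOfIntegration ((W₀ ∩ ballV b ε z) ∩ E') θ₀ ξ₀ := (hd.inter hbVm).restrictSet_eq hE'm
    have h2c : (currentOfIntegration (W₀ ∩ ballV b ε z) θ₀ ξ₀ : Current (⊤ : Opens V) (k + 1)) =
        currentOfIntegration (faceV b ε z) (fun _ => a) (fun _ => ff) := by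
      rw [← hd.restrictSet_eq hbVm]; exact ha
    have h2d : (hd.inter hbVm).isRepresentable.restrictSet E' hE'm =
        (isRepresentable_vectorCurrent hconst).restrictSet E' hE'm :=
      Current.IsRepresentable.restrictSet_congr_current h2c _ _ hE'm
    have h2e : (isRepresentable_vectorCurrent hconst).restrictSet E' hE'm =
        (currentOfIntegration (faceV b ε z ∩ E') (fun _ => a) (fun _ => ff) :
          Current (⊤ : Opens V) (k + 1)) := by
      rw [restrictSet_vectorCurrent hconst hE'm, Measure.restrict_restrict hE'm, inter_comm]
      rfl
    rw [h2a, show W₀ ∩ (E' ∩ ballV b ε z) = (W₀ ∩ ballV b ε z) ∩ E' by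
      rw [inter_assoc, inter_comm E'], ← h2b, h2d, h2e]
  -- (3) as an integral over the face
  have hfinμ' : (μHE[k + 1] : Measure V) (faceV b ε z ∩ E') < ⊤ :=
    (measure_mono inter_subset_left).trans_lt hfinμ
  haveI : IsFiniteMeasure ((μHE[k + 1] : Measure V).restrict (faceV b ε z ∩ E')) :=
    ⟨by rw [Measure.restrict_apply_univ]; exact hfinμ'⟩
  have hconst' : LocallyIntegrableOn (fun _ : V => ((a : ℤ) : ℝ) • frameVector ff)
      ((⊤ : Opens V) : Set V) ((μHE[k + 1] : Measure V).restrict (faceV b ε z ∩ E')) :=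
    (integrable_const _).locallyIntegrable.locallyIntegrableOn _
  have h3 : (currentOfIntegration (faceV b ε z ∩ E') (fun _ => a) (fun _ => ff) :
      Current (⊤ : Opens V) (k + 1)) χ =
      (a : ℝ) * ∫ y in faceV b ε z ∩ E', χ y ff ∂(μHE[k + 1] : Measure V) := by
    rw [currentOfIntegration_apply hconst', ← integral_const_mul]
  -- (4) area formula along the affine isometric chart `Ψ₀`
  set S' : Set K := {y | Ψ₀ y ∈ ballV b ε z} ∩ {y | s < f (Ψ₀ y)} with hS'
  have hS'o : IsOpen S' :=
    ((isOpen_ballV b z).preimage hΨ₀cont).inter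
      ((isOpen_lt continuous_const hfs.continuous).preimage hΨ₀cont)
  have hS'm : MeasurableSet S' := hS'o.measurableSet
  have himS' : Ψ₀ '' S' = faceV b ε z ∩ E' := by
    apply Subset.antisymm
    · rintro _ ⟨y, ⟨hyb, hyE⟩, rfl⟩
      exact ⟨hplane.subset ⟨hyb, hΨ₀plane y⟩, (hE'eq _).2 hyE⟩
    · rintro w ⟨hwf, hwE⟩
      have hwK : w - c ∈ K := hfaceplane hwf
      have hw : Ψ₀ ⟨w - c, hwK⟩ = w := by show c + (w - c) = w; abel
      exact ⟨⟨w - c, hwK⟩, ⟨by show Ψ₀ ⟨w - c, hwK⟩ ∈ ballV b ε z; rw [hw]; exact hfacebV hwf,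
        by show s < f (Ψ₀ ⟨w - c, hwK⟩); rw [hw]; exact (hE'eq _).1 hwE⟩, hw⟩
  have h4 : ∫ y in faceV b ε z ∩ E', χ y ff ∂(μHE[k + 1] : Measure V) =
      ∫ y in S', χ (Ψ₀ y) ff := by
    rw [← himS']
    have hAF := Literature.Analysis.Calculus.integral_image_eq_integral_normDet_smul (V := V) hS'm
      (fun y _ => (hΨ₀D y).hasFDerivWithinAt) (fun y _ => hDinj) (hΨ₀inj.injOn) (fun w => χ w ff)
    rw [hK] at hAF
    rw [hAF]
    refine setIntegral_congr_fun hS'm fun y _ => ?_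
    rw [hnormDet, one_smul]
  -- (5) transport to `ℝ^{k+1}` by `Lc`
  set H : (Fin (k + 1) → ℝ) → ℝ := fun u =>
    ((extDeriv ⇑φ (Ψ u)).compContinuousLinearMap (fderiv ℝ Ψ u)) (fun j => Pi.single j 1) with hH
  have hHLc : ∀ y : K, H (Lc y) = χ (Ψ₀ y) ff := fun y => by
    have hΨy : Ψ (Lc y) = Ψ₀ y := by
      show Ψ₀ (Lc.symm (Lc y)) = Ψ₀ y
      rw [ContinuousLinearEquiv.symm_apply_apply]
    show ((extDeriv ⇑φ (Ψ (Lc y))).compContinuousLinearMap (fderiv ℝ Ψ (Lc y)))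
        (fun j => Pi.single j 1) = _
    rw [ContinuousAlternatingMap.compContinuousLinearMap_apply, hχcoe, hΨy]
    congr 1
    funext j
    rw [Function.comp_apply, hΨframe]
  have hLcS' : Lc '' S' = O₀ ∩ {u | s < G u} := by
    rw [ContinuousLinearEquiv.image_eq_preimage_symm]
    exact Set.ext fun u => Iff.rfl
  have h5 : ∫ y in S', χ (Ψ₀ y) ff = ∫ u in O₀ ∩ {u | s < G u}, H u := by
    rw [← hLcS', hLcmp.setIntegral_image_emb hLcemb H S']
    exact setIntegral_congr_fun hS'm fun y _ => (hHLc y).symm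
  -- (6) shrink to `O₁`: `dφ ∘ Ψ = 0` on `O₀ ∖ O₁`
  have hGo : IsOpen (O₀ ∩ {u | s < G u}) :=
    hO₀o.inter (isOpen_lt continuous_const hGs.continuous)
  have h6 : ∫ u in O₀ ∩ {u | s < G u}, H u = ∫ u in O₁ ∩ {u | s < G u}, H u := by
    refine setIntegral_eq_of_subset_of_forall_sdiff_eq_zero hGo.measurableSet
      (inter_subset_inter_left _ hO₁O₀) ?_
    rintro u ⟨⟨huO₀, hus⟩, hu1⟩
    have huO₁ : u ∉ O₁ := fun h => hu1 ⟨h, hus⟩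
    have hΨu : Ψ u ∉ tsupport ⇑φ := fun h => huO₁ (by
      have h' : ℓ (Ψ u) ∈ O₁ := (hφO h).2
      rwa [hℓΨ u] at h')
    show ((extDeriv ⇑φ (Ψ u)).compContinuousLinearMap (fderiv ℝ Ψ u)) (fun j => Pi.single j 1) = 0
    rw [ContinuousAlternatingMap.compContinuousLinearMap_apply,
      TestForm.extDeriv_eq_zero_of_notMem_tsupport φ hΨu]
    rfl
  -- (7) the level-set current of the chart
  set C : Set (Fin (k + 1) → ℝ) := ℓ '' tsupport ⇑φ with hC
  have hCc : IsCompact C := φ.hasCompactSupport.isCompact.image hℓ.continuous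
  have hCO₁ : C ⊆ O₁ := by
    rintro _ ⟨y, hy, rfl⟩
    exact (hφO hy).2
  have hvan : ∀ u ∈ O₀, u ∉ C → ⇑φ (Ψ u) = 0 := fun u _ huC => by
    by_contra hne
    exact huC ⟨Ψ u, subset_tsupport _ (Function.mem_support.2 hne), hℓΨ u⟩
  have h7 : ∫ u in O₁ ∩ {u | s < G u}, H u =
      currentOfIntegration (Ψ '' (O₁ ∩ G ⁻¹' {s})) θ ν φ := hident U φ C hCc hCO₁ hvan
  -- (8) assemble
  have hθU : LocallyIntegrableOn (fun y => (θ y : ℝ) • frameVector (ν y)) (U : Set V)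
      ((μHE[k] : Measure V).restrict (Ψ '' (O₁ ∩ G ⁻¹' {s}))) :=
    hdata'.2.2.2.1.mono_set (subset_univ _)
  rw [h0, h1, h2, h3, h4, h5, h6, h7, hMO, currentOfIntegration_const_mul_apply' hθU]


/-! ### Gluing the local slices off the lower skeleton -/

/-- **The slice glued off `μ_ε W'_k`.** For a polyhedral `(k+1)`-cycle `P` as above, `x ∈ V` and a
level `s` at which every point of every top face carries the local slice data of
`Current.IsRectifiable.exists_polyhedral_sliceData`, the boundary `∂(P ⌞ B(x, √(-s)))` read on the
open set `U = V ∖ μ_ε W'_k` IS a current of integration `[M_s, θ, ν]` with admissible data on `U`,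
`M_s = f⁻¹{s} ∩ (μ_ε W'_{k+1} ∖ μ_ε W'_k)`, `f = -‖· - x‖²`: the local data glue
(`Current.exists_isRectifiableData_of_locally`); off `M_s` the boundary vanishes locally — inside
the ball it is `∂P = 0`, outside the closed ball and off `μ_ε W'_{k+1} ⊇ spt P` trivially.
[cite: Federer1969, 4.3.8, 4.1.28 (4)] -/
theorem Current.IsRectifiable.exists_isRectifiableData_polyhedral_slice_eq
    (b : OrthonormalBasis (Fin n) ℝ V) {k : ℕ} {ε : ℝ} {P : Current (⊤ : Opens V) (k + 1)}
    (hPr : P.IsRepresentable) (hcyc : P.boundary = 0) (hsupp : P.support ⊆ skeletonV b (k + 1) ε)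
    (x : V) {s : ℝ}
    (hloc : ∀ z : Fin n → ℤ, faceDim z = k + 1 → ∀ p ∈ faceV b ε z, -‖p - x‖ ^ 2 = s →
      ∃ O : Set V, IsOpen O ∧ p ∈ O ∧ ∃ (θ : V → ℤ) (ν : V → Fin k → V),
        IsRectifiableData (⊤ : Opens V) k
          ((fun y : V => -‖y - x‖ ^ 2) ⁻¹' {s} ∩ (skeletonV b (k + 1) ε \ skeletonV b k ε) ∩ O) θ ν ∧
        ∀ (U : Opens V) (φ : TestForm U k), tsupport ⇑φ ⊆ O →
          ((hPr.restrictSet (ball x (Real.sqrt (-s))) measurableSet_ball).boundary.comp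
            (TestFunction.monoCLM ℝ) : Current U k) φ =
          currentOfIntegration
            ((fun y : V => -‖y - x‖ ^ 2) ⁻¹' {s} ∩ (skeletonV b (k + 1) ε \ skeletonV b k ε) ∩ O)
            θ ν φ) :
    ∃ (θ : V → ℤ) (ν : V → Fin k → V),
      IsRectifiableData (⟨(skeletonV b k ε)ᶜ, (isClosed_skeletonV b).isOpen_compl⟩ : Opens V) k
        ((fun y : V => -‖y - x‖ ^ 2) ⁻¹' {s} ∩ (skeletonV b (k + 1) ε \ skeletonV b k ε)) θ ν ∧
      ((hPr.restrictSet (ball x (Real.sqrt (-s))) measurableSet_ball).boundary.comp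
          (TestFunction.monoCLM ℝ) :
          Current (⟨(skeletonV b k ε)ᶜ, (isClosed_skeletonV b).isOpen_compl⟩ : Opens V) k) =
        currentOfIntegration
          ((fun y : V => -‖y - x‖ ^ 2) ⁻¹' {s} ∩ (skeletonV b (k + 1) ε \ skeletonV b k ε)) θ ν := by
  classical
  set f : V → ℝ := fun y => -‖y - x‖ ^ 2 with hfdef
  have hfs : ContDiff ℝ ∞ f := ((contDiff_norm_sq ℝ).comp (contDiff_id.sub contDiff_const)).neg
  set M : Set V := f ⁻¹' {s} ∩ (skeletonV b (k + 1) ε \ skeletonV b k ε) with hMdef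
  set U : Opens V := ⟨(skeletonV b k ε)ᶜ, (isClosed_skeletonV b).isOpen_compl⟩ with hU
  have hleU : U ≤ (⊤ : Opens V) := le_top
  set E' : Set V := ball x (Real.sqrt (-s)) with hE'
  have hE'eq : ∀ y, y ∈ E' ↔ s < f y := fun y => by
    rw [hE', mem_ball, dist_eq_norm, Real.lt_sqrt (norm_nonneg _)]
    show _ ↔ s < -‖y - x‖ ^ 2
    constructor <;> intro h <;> linarith
  set Z : Current U k := ((hPr.restrictSet E' measurableSet_ball).boundary.comp
    (TestFunction.monoCLM ℝ) : Current U k) with hZ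
  have hZapply : ∀ φ : TestForm U k,
      Z φ = hPr.restrictSet E' measurableSet_ball (TestForm.extDerivCLM (TestFunction.monoCLM ℝ φ)) :=
    fun φ => rfl
  have hdsupp : ∀ φ : TestForm U k,
      Function.support ⇑(TestForm.extDerivCLM (TestFunction.monoCLM ℝ φ) : TestForm (⊤ : Opens V) (k + 1))
        ⊆ tsupport ⇑φ := fun φ => by
    refine (subset_tsupport _).trans ((TestForm.tsupport_extDerivCLM_subset _).trans ?_)
    rw [TestForm.monoCLM_apply_of_le hleU]
  have hMm : MeasurableSet M :=
    (hfs.continuous.measurable (measurableSet_singleton s)).inter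
      ((isClosed_skeletonV b).measurableSet.diff (isClosed_skeletonV b).measurableSet)
  have hMU : M ⊆ (U : Set V) := fun y hy => hy.2.2
  refine Z.exists_isRectifiableData_of_locally hMm hMU (fun y hy => ?_) (fun y hyU hyM => ?_)
  · -- local data at the points of `M`
    obtain ⟨hys, hyk1, hyk⟩ := hy
    obtain ⟨z, hzle, hyz⟩ := Set.mem_iUnion₂.1 (skeletonV_subset_iUnion_faceV b (k + 1) hyk1)
    have hz : faceDim z = k + 1 := by
      rcases (Nat.le_succ_iff.1 hzle) with hle | heq
      · exact absurd (skeleton_mono hle (faceV_subset_skeletonV b z hyz)) hyk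
      · exact heq
    obtain ⟨O, hOo, hyO, θ, ν, hd, hident⟩ := hloc z hz y hyz hys
    have hd' : IsRectifiableData (⊤ : Opens V) k (M ∩ O) θ ν := hd
    refine ⟨O, hOo, hyO, θ, ν, ?_, hident U⟩
    have h1 := hd'.inter_of_le hleU
    rwa [inter_eq_left.2 (inter_subset_left.trans hMU)] at h1
  · -- off `M` the boundary vanishes locally
    by_cases hfy : f y = s
    · -- `f y = s`, so `y ∉ μ_ε W'_{k+1}`
      have hyk1 : y ∉ skeletonV b (k + 1) ε := fun h => hyM ⟨hfy, h, hyU⟩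
      refine ⟨(skeletonV b (k + 1) ε)ᶜ, (isClosed_skeletonV b).isOpen_compl, hyk1,
        Set.disjoint_left.2 fun w hw hwM => hw hwM.2.1, fun φ hφ => ?_⟩
      rw [hZapply]
      -- `∫_{E'} ‖dφ‖ d‖P‖ = 0`: `dφ` lives off `spt P`
      set χ : TestForm (⊤ : Opens V) (k + 1) := TestForm.extDerivCLM (TestFunction.monoCLM ℝ φ)
      have hχP : Disjoint (tsupport ⇑χ) P.support := by
        refine Set.disjoint_left.2 fun w hw hwP => ?_
        have h1 : w ∈ tsupport ⇑φ := by
          have := (TestForm.tsupport_extDerivCLM_subset (TestFunction.monoCLM ℝ φ)) hw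
          rwa [TestForm.monoCLM_apply_of_le hleU] at this
        exact hφ h1 (hsupp hwP)
      have hvar : P.variation (tsupport ⇑χ) = 0 := by
        refine measure_mono_null (fun w hw => ?_) P.variation_sdiff_support
        exact ⟨mem_univ w, hχP.notMem_of_mem_left hw⟩
      have hle := hPr.abs_restrictSet_apply_le E' measurableSet_ball χ
      have hint : ∫⁻ w in E', ‖χ w‖ₑ ∂P.variation = 0 := by
        refine le_antisymm ?_ bot_le
        calc ∫⁻ w in E', ‖χ w‖ₑ ∂P.variation ≤ ∫⁻ w, ‖χ w‖ₑ ∂P.variation :=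
              setLIntegral_le_lintegral _ _
          _ = ∫⁻ w in tsupport ⇑χ, ‖χ w‖ₑ ∂P.variation := by
              refine (setLIntegral_eq_of_support_subset fun w hw => ?_).symm
              exact subset_tsupport _ (by simpa using hw)
          _ = 0 := setLIntegral_measure_zero _ _ hvar
      rw [hint, ENNReal.toReal_zero, abs_nonpos_iff] at hle
      exact hle
    · rcases lt_or_gt_of_ne hfy with hlt | hgt
      · -- `f y < s`: outside the closed ball
        refine ⟨{w | f w < s}, isOpen_lt hfs.continuous continuous_const, hlt,
          Set.disjoint_left.2 fun w hw hwM => (show f w < s from hw).ne hwM.1, fun φ hφ => ?_⟩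
        rw [hZapply]
        refine hPr.restrictSet_apply_of_disjoint _ (Set.disjoint_left.2 fun w hw hwE => ?_)
        have h1 : f w < s := hφ ((hdsupp φ) hw)
        exact lt_asymm h1 ((hE'eq w).1 hwE)
      · -- `s < f y`: inside the ball, where `∂(P ⌞ E') = ∂P = 0`
        refine ⟨E', isOpen_ball, (hE'eq y).2 hgt,
          Set.disjoint_left.2 fun w hw hwM => ((hE'eq w).1 hw).ne' hwM.1, fun φ hφ => ?_⟩
        rw [hZapply, hPr.restrictSet_apply_of_support_subset _ ((hdsupp φ).trans hφ),
          ← Current.boundary_apply, hcyc]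
        rfl

/-! ### Exceptional levels -/

/-- **The lower skeleton meets almost every sphere in an `𝓗ᵏ`-null set**: for all but countably many
levels `s`, `𝓗ᵏ(μ_ε W'_k ∩ f⁻¹{s}) = 0` (`f = -‖· - x‖²`) — the `k`-skeleton is a countable union of
faces of finite `𝓗ᵏ`-measure (and null lower faces), each charging only countably many levels.
[cite: Federer1969, 4.2.5, 2.10.19] -/
theorem Cubical.ae_euclideanHausdorffMeasure_skeletonV_inter_levelSet_eq_zero
    (b : OrthonormalBasis (Fin n) ℝ V) (k : ℕ) {ε : ℝ} (hε : 0 < ε) (x : V) :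
    ∀ᵐ s : ℝ, (μHE[k] : Measure V) (skeletonV b k ε ∩ (fun y : V => -‖y - x‖ ^ 2) ⁻¹' {s}) = 0 := by
  set f : V → ℝ := fun y => -‖y - x‖ ^ 2 with hfdef
  have hfc : Continuous f := ((continuous_norm.comp (continuous_id.sub continuous_const)).pow 2).neg
  -- each face of dimension `≤ k` charges countably many levels
  have hface : ∀ z : Fin n → ℤ, faceDim z ≤ k →
      ∀ᵐ s : ℝ, (μHE[k] : Measure V) (faceV b ε z ∩ f ⁻¹' {s}) = 0 := by
    intro z hz
    have hfin : (μHE[k] : Measure V) (faceV b ε z) < ⊤ := by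
      rcases hz.lt_or_eq with hlt | heq
      · rw [euclideanHausdorffMeasure_faceV_eq_zero b hlt]; exact ENNReal.zero_lt_top
      · exact euclideanHausdorffMeasure_faceV_lt_top b hε heq
    haveI : IsFiniteMeasure ((μHE[k] : Measure V).restrict (faceV b ε z)) :=
      ⟨by rw [Measure.restrict_apply_univ]; exact hfin⟩
    have hcount : {s : ℝ | 0 < ((μHE[k] : Measure V).restrict (faceV b ε z)) {y | f y = s}}.Countable :=
      Measure.countable_meas_level_set_pos hfc.measurable
    filter_upwards [hcount.ae_notMem volume] with s hs
    simp only [not_lt, nonpos_iff_eq_zero] at hs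
    rw [Measure.restrict_apply' (measurableSet_faceV b z)] at hs
    rw [show faceV b ε z ∩ f ⁻¹' {s} = {y | f y = s} ∩ faceV b ε z from by
      ext y; simp only [mem_inter_iff, mem_preimage, mem_singleton_iff, mem_setOf_eq]; tauto]
    exact hs
  have hall : ∀ᵐ s : ℝ, ∀ z : Fin n → ℤ, faceDim z ≤ k →
      (μHE[k] : Measure V) (faceV b ε z ∩ f ⁻¹' {s}) = 0 := by
    rw [ae_all_iff]; intro z
    by_cases hz : faceDim z ≤ k
    · filter_upwards [hface z hz] with s hs _ using hs
    · exact Eventually.of_forall fun s h => absurd h hz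
  filter_upwards [hall] with s hs
  refine measure_mono_null (fun y hy => ?_)
    ((measure_biUnion_null_iff (Set.to_countable {z : Fin n → ℤ | faceDim z ≤ k})).2 fun z hz => hs z hz)
  obtain ⟨z, hz, hyz⟩ := Set.mem_iUnion₂.1 (skeletonV_subset_iUnion_faceV b k hy.1)
  exact Set.mem_iUnion₂.2 ⟨z, hz, hyz, hy.2⟩

omit [FiniteDimensional ℝ V] [MeasurableSpace V] [BorelSpace V] in
/-- The support of a current on the whole space is closed. [cite: Federer1969, 4.1.1] -/
private theorem Current.isClosed_support_top' {m : ℕ} (T : Current (⊤ : Opens V) m) :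
    IsClosed T.support := by
  have h := T.isOpen_sdiff_support
  rw [TopologicalSpace.Opens.coe_top, ← Set.compl_eq_univ_sdiff] at h
  exact isOpen_compl_iff.1 h

omit [InnerProductSpace ℝ V] [FiniteDimensional ℝ V] in
/-- A `μHE[0]`-null set is empty. [folklore] -/
private theorem eq_empty_of_euclideanHausdorffMeasure_zero_eq_zero {S : Set V}
    (h : (μHE[0] : Measure V) S = 0) : S = ∅ := by
  by_contra hne
  obtain ⟨y, hy⟩ := nonempty_iff_ne_empty.2 hne
  rw [Measure.euclideanHausdorffMeasure_zero] at h
  have h1 : (μH[0] : Measure V) {y} ≤ (μH[0] : Measure V) S := measure_mono (singleton_subset_iff.2 hy)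
  rw [Measure.hausdorffMeasure_zero_singleton, h] at h1
  exact one_ne_zero (le_antisymm h1 bot_le)

/-! ### Sphere slices of polyhedral cycles are rectifiable -/

/-- **Sphere slices of integral polyhedral cycles are rectifiable currents (open balls, levels).**
For `P ∈ 𝓡_{k+1}(V)` a cycle carried by `μ_ε W'_{k+1}` and `x ∈ V`: for almost every level `s < 0`,
if `𝐌(∂(P ⌞ B(x, √(-s)))) < ∞` then `∂(P ⌞ B(x, √(-s))) ∈ 𝓡_k(V)`. Proof along [Federer1969, 4.3.8]
for this flat case: glue the local slices off `μ_ε W'_k`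
(`Current.IsRectifiable.exists_isRectifiableData_polyhedral_slice_eq`); the glued multiplicity is
summable by the mass formula and the finite slice mass, so the data are admissible on the whole
space; `-[slice] + ∂(P ⌞ B)` is then an integral flat chain supported in `μ_ε W'_k ∩ f⁻¹{s}`, an
`𝓗ᵏ`-null set for a.e. `s`, hence zero by the support theorem [Federer1969, 4.1.20] (`k ≥ 1`) or
because its support is empty (`k = 0`). [cite: Federer1969, 4.3.8, 4.2.1, 4.1.20] -/
theorem Current.IsRectifiable.ae_isRectifiable_boundary_restrictSet_ball_sqrt
    (b : OrthonormalBasis (Fin n) ℝ V) {k : ℕ} {ε : ℝ} (hε : 0 < ε) {P : Current (⊤ : Opens V) (k + 1)}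
    (hP : P.IsRectifiable) (hPr : P.IsRepresentable) (hcyc : P.boundary = 0)
    (hsupp : P.support ⊆ skeletonV b (k + 1) ε) (x : V) :
    ∀ᵐ s : ℝ, ((hPr.restrictSet (ball x (Real.sqrt (-s))) measurableSet_ball).boundary).mass < ⊤ →
      ((hPr.restrictSet (ball x (Real.sqrt (-s))) measurableSet_ball).boundary).IsRectifiable := by
  classical
  set f : V → ℝ := fun y => -‖y - x‖ ^ 2 with hfdef
  have hfs : ContDiff ℝ ∞ f := ((contDiff_norm_sq ℝ).comp (contDiff_id.sub contDiff_const)).neg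
  -- the exceptional levels: Sard on every top face, and the null slices of the lower skeleton
  choose Bad hBad hgood using fun (z : Fin n → ℤ) (hz : faceDim z = k + 1) =>
    hP.exists_polyhedral_sliceData b hε hPr hcyc hsupp x hz
  set Bad' : (Fin n → ℤ) → Set ℝ := fun z => if hz : faceDim z = k + 1 then Bad z hz else ∅ with hBad'
  have hBad'0 : volume (⋃ z, Bad' z) = 0 := by
    refine measure_iUnion_null fun z => ?_
    by_cases hz : faceDim z = k + 1
    · simp only [hBad', dif_pos hz]; exact hBad z hz
    · simp only [hBad', dif_neg hz, measure_empty]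
  filter_upwards [measure_eq_zero_iff_ae_notMem.1 hBad'0,
    Cubical.ae_euclideanHausdorffMeasure_skeletonV_inter_levelSet_eq_zero b k hε x] with s hs hnull hmass
  have hs' : ∀ z (hz : faceDim z = k + 1), s ∉ Bad z hz := fun z hz h =>
    hs (mem_iUnion.2 ⟨z, by simp only [hBad', dif_pos hz]; exact h⟩)
  -- notation
  set U : Opens V := ⟨(skeletonV b k ε)ᶜ, (isClosed_skeletonV b).isOpen_compl⟩ with hU
  have hleU : U ≤ (⊤ : Opens V) := le_top
  set E' : Set V := ball x (Real.sqrt (-s)) with hE'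
  have hE'eq : ∀ y, y ∈ E' ↔ s < f y := fun y => by
    rw [hE', mem_ball, dist_eq_norm, Real.lt_sqrt (norm_nonneg _)]
    show _ ↔ s < -‖y - x‖ ^ 2
    constructor <;> intro h <;> linarith
  set M : Set V := f ⁻¹' {s} ∩ (skeletonV b (k + 1) ε \ skeletonV b k ε) with hMdef
  set ZT : Current (⊤ : Opens V) k := (hPr.restrictSet E' measurableSet_ball).boundary with hZT
  -- (1) glue on `U`
  obtain ⟨θ₁, ν₁, hd₁', hglue'⟩ := Current.IsRectifiable.exists_isRectifiableData_polyhedral_slice_eq b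
    hPr hcyc hsupp x (fun z hz p hp hfp => hgood z hz s (hs' z hz) p hp hfp)
  have hd₁ : IsRectifiableData U k M θ₁ ν₁ := hd₁'
  have hglue : ((hPr.restrictSet E' measurableSet_ball).boundary.comp (TestFunction.monoCLM ℝ) :
      Current U k) = currentOfIntegration M θ₁ ν₁ := hglue'
  clear hd₁' hglue'
  have hnull' : (μHE[k] : Measure V) (skeletonV b k ε ∩ f ⁻¹' {s}) = 0 := hnull
  -- (2) the glued multiplicity is summable: `∫_M |θ₁| = 𝐌(Z|U) ≤ 𝐌(Z) < ∞`
  have hfin : ∫⁻ y in M, ‖(θ₁ y : ℝ)‖ₑ ∂(μHE[k] : Measure V) < ⊤ := by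
    rw [← hd₁.mass_eq, ← hglue]
    exact (Current.mass_comp_monoCLM_le' hleU ZT).trans_lt hmass
  -- (3) the data are admissible on the whole space
  have hdT : IsRectifiableData (⊤ : Opens V) k M θ₁ ν₁ :=
    hd₁.of_lintegral_lt_top' hfin (subset_univ _)
  -- (4) `-[M, θ₁, ν₁] + ∂(P ⌞ E') = 0` on the whole space
  obtain ⟨⟨W₀, θ₀, ξ₀, hd, rfl⟩, hcpt⟩ := hP
  set ST : Current (⊤ : Opens V) (k + 1) := hPr.restrictSet E' measurableSet_ball with hST
  have hSloc : ST.IsLocallyRectifiable := hd.isLocallyRectifiable_restrictSet measurableSet_ball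
  set R : Current (⊤ : Opens V) k := currentOfIntegration M (fun y => -θ₁ y) ν₁ with hR
  have hRloc : R.IsLocallyRectifiable := ⟨_, _, _, hdT.neg, rfl⟩
  have hRST : ∀ φ : TestForm (⊤ : Opens V) k, tsupport ⇑φ ⊆ (U : Set V) →
      R φ + ST.boundary φ = 0 := by
    intro φ hφ
    set ψ : TestForm U k := ⟨⇑φ, φ.contDiff, φ.hasCompactSupport, hφ⟩ with hψ
    have hψφ : (TestFunction.monoCLM ℝ ψ : TestForm (⊤ : Opens V) k) = φ := by
      apply TestFunction.ext
      intro y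
      rw [TestForm.monoCLM_apply_of_le hleU]
      rfl
    rw [← hψφ]
    have h1 : R (TestFunction.monoCLM ℝ ψ) =
        (currentOfIntegration M (fun y => -θ₁ y) ν₁ : Current U k) ψ := by
      rw [hR, currentOfIntegration_eq_comp_monoCLM hleU hdT.neg.2.2.2.1]
      rfl
    have h2 : ST.boundary (TestFunction.monoCLM ℝ ψ) =
        (ST.boundary.comp (TestFunction.monoCLM ℝ) : Current U k) ψ := rfl
    rw [h1, h2, hglue, currentOfIntegration_neg]
    simp
  have hsupp' : (R + ST.boundary).support ⊆ skeletonV b k ε ∩ f ⁻¹' {s} := by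
    intro y hy
    by_contra hys
    rcases not_and_or.1 hys with hyk | hyf
    · -- near a point of `U` the currents cancel
      exact Current.notMem_support_of_forall_apply_eq_zero _ U.isOpen hRST hyk hy
    · -- off `f⁻¹{s}` both currents vanish near `y`
      have hfy : f y ≠ s := hyf
      have hRzero : ∀ (O : Set V), Disjoint O (f ⁻¹' {s}) → ∀ φ : TestForm (⊤ : Opens V) k,
          tsupport ⇑φ ⊆ O → R φ = 0 := by
        intro O hO φ hφ
        rw [hR, currentOfIntegration_apply hdT.neg.2.2.2.1]
        refine setIntegral_eq_zero_of_forall_eq_zero fun w hw => ?_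
        have hwφ : w ∉ tsupport ⇑φ := fun h => hO.notMem_of_mem_left (hφ h) hw.1
        simp [image_eq_zero_of_notMem_tsupport hwφ]
      have hdsupp : ∀ φ : TestForm (⊤ : Opens V) k,
          Function.support ⇑(TestForm.extDerivCLM φ) ⊆ tsupport ⇑φ := fun φ =>
        (subset_tsupport _).trans (TestForm.tsupport_extDerivCLM_subset _)
      rcases lt_or_gt_of_ne hfy with hlt | hgt
      · refine Current.notMem_support_of_forall_apply_eq_zero _
          (isOpen_lt hfs.continuous continuous_const) (fun φ hφ => ?_) hlt hy
        show R φ + ST.boundary φ = 0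
        rw [hRzero {w | f w < s} (Set.disjoint_left.2 fun w hw hws => (show f w < s from hw).ne hws)
          φ hφ, zero_add, Current.boundary_apply, hST]
        refine hPr.restrictSet_apply_of_disjoint _ (Set.disjoint_left.2 fun w hw hwE => ?_)
        exact lt_asymm (show f w < s from hφ ((hdsupp φ) hw)) ((hE'eq w).1 hwE)
      · refine Current.notMem_support_of_forall_apply_eq_zero _ isOpen_ball (fun φ hφ => ?_)
          ((hE'eq y).2 hgt) hy
        show R φ + ST.boundary φ = 0
        rw [hRzero E' (Set.disjoint_left.2 fun w hw hws => ((hE'eq w).1 hw).ne' hws) φ hφ, zero_add,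
          Current.boundary_apply, hST, hPr.restrictSet_apply_of_support_subset _ ((hdsupp φ).trans hφ),
          ← Current.boundary_apply, hcyc]
        rfl
  have hzero : R + ST.boundary = 0 := by
    have h0 : (μHE[k] : Measure V) (R + ST.boundary).support = 0 :=
      measure_mono_null hsupp' hnull'
    cases k with
    | zero =>
      exact Current.eq_zero_of_support_eq_empty _ (eq_empty_of_euclideanHausdorffMeasure_zero_eq_zero h0)
    | succ k => exact Current.add_boundary_eq_zero_of_isLocallyRectifiable hRloc hSloc h0
  have hST' : ST.boundary = currentOfIntegration M θ₁ ν₁ := by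
    rw [hR, currentOfIntegration_neg, neg_add_eq_zero] at hzero
    exact hzero.symm
  -- (5) conclusion: locally rectifiable with compact support
  have hloc' : ZT.IsLocallyRectifiable := ⟨M, θ₁, ν₁, hdT, hST'⟩
  have hcptZ : IsCompact ZT.support :=
    hcpt.of_isClosed_subset (Current.isClosed_support_top' _)
      ((Current.support_boundary_subset _).trans (hPr.support_restrictSet_subset _))
  exact ⟨hloc', hcptZ⟩

/-- **Sphere slices of integral polyhedral cycles are rectifiable, almost every radius.** For
`P ∈ 𝓡_{k+1}(V)` with `∂P = 0` and `spt P ⊆ μ_ε W'_{k+1}` (the output class of the deformation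
theorem `Current.IsRectifiable.exists_deformation_of_cycle`) and `x ∈ V`: for almost every `r > 0`
the boundary of the piece `P ⌞ 𝐁(x, r)` is a rectifiable `k`-current, `∂(P ⌞ 𝐁(x, r)) ∈ 𝓡_k(V)`,
and `P ⌞ 𝐁(x, r) = P ⌞ B(x, r)` (the sphere is `‖P‖`-null). The level `s = -r²` is good for
`Current.IsRectifiable.ae_isRectifiable_boundary_restrictSet_ball_sqrt` for a.e. `r` (`√` is
differentiable off `0`, so it maps null sets of levels to null sets of radii), the slice mass
`𝐌 ∂(P ⌞ 𝐁(x, r)) ≤ C f'(r)` is finite for a.e. `r` (`Current.ae_mass_boundary_piece_le_deriv`),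
and all but countably many spheres are `‖P‖`-null. [cite: Federer1969, 4.2.1, 4.3.8] -/
theorem Current.IsRectifiable.ae_isRectifiable_boundary_restrictSet_closedBall
    (b : OrthonormalBasis (Fin n) ℝ V) {k : ℕ} {ε : ℝ} (hε : 0 < ε) {P : Current (⊤ : Opens V) (k + 1)}
    (hP : P.IsRectifiable) (hPr : P.IsRepresentable) (hcyc : P.boundary = 0)
    (hsupp : P.support ⊆ skeletonV b (k + 1) ε) (x : V) :
    ∀ᵐ r : ℝ, 0 < r →
      (hPr.restrictSet (closedBall x r) measurableSet_closedBall).boundary.IsRectifiable ∧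
      hPr.restrictSet (closedBall x r) measurableSet_closedBall =
        hPr.restrictSet (ball x r) measurableSet_ball := by
  have hPm : P.mass ≠ ⊤ := hP.mass_ne_top'
  haveI : IsFiniteMeasure P.variation := P.isFiniteMeasure_variation hPm
  -- (a) good levels transported to radii
  obtain ⟨N, hNm, hN0, hN⟩ : ∃ N : Set ℝ, MeasurableSet N ∧ volume N = 0 ∧ ∀ s ∉ N,
      ((hPr.restrictSet (ball x (Real.sqrt (-s))) measurableSet_ball).boundary).mass < ⊤ →
      ((hPr.restrictSet (ball x (Real.sqrt (-s))) measurableSet_ball).boundary).IsRectifiable := by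
    have h := hP.ae_isRectifiable_boundary_restrictSet_ball_sqrt b hε hPr hcyc hsupp x
    rw [ae_iff] at h
    refine ⟨toMeasurable volume _, measurableSet_toMeasurable _ _, by rwa [measure_toMeasurable],
      fun s hs => ?_⟩
    have : ¬¬(_ → _) := fun h' => hs (subset_toMeasurable _ _ h')
    exact not_not.1 this
  set g : ℝ → ℝ := fun s => Real.sqrt (-s) with hg
  have hgdiff : DifferentiableOn ℝ g (N ∩ Iio 0) := fun s hs =>
    ((Real.hasDerivAt_sqrt (show -s ≠ 0 by have := hs.2; simp only [mem_Iio] at this; linarith)).comp s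
      (hasDerivAt_neg s)).differentiableAt.differentiableWithinAt
  have himg0 : volume (g '' (N ∩ Iio 0)) = 0 :=
    addHaar_image_eq_zero_of_differentiableOn_of_addHaar_eq_zero volume hgdiff
      (measure_mono_null inter_subset_left hN0)
  -- (b) countably many charged spheres
  have hcount : {r : ℝ | 0 < P.variation {y | dist y x = r}}.Countable :=
    Measure.countable_meas_level_set_pos (continuous_id.dist continuous_const).measurable
  filter_upwards [measure_eq_zero_iff_ae_notMem.1 himg0, hcount.ae_notMem volume,
    P.ae_mass_boundary_piece_le_deriv hPm hcyc x] with r hrN hr0 hmass hr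
  -- the sphere is null, so the two pieces agree
  have hsph : P.variation (sphere x r) = 0 := by
    simp only [not_lt, nonpos_iff_eq_zero] at hr0
    exact hr0
  have heq : hPr.restrictSet (closedBall x r) measurableSet_closedBall =
      hPr.restrictSet (ball x r) measurableSet_ball := by
    refine hPr.restrictSet_congr_ae _ _ ?_
    have : (ball x r : Set V) =ᵐ[P.variation] (closedBall x r : Set V) := by
      rw [← ball_union_sphere]
      refine (union_ae_eq_left_of_ae_eq_empty ?_).symm
      exact (ae_eq_empty.2 hsph)
    exact this.symm
  refine ⟨?_, heq⟩
  -- the level `s = -r²` is good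
  set s : ℝ := -r ^ 2 with hs
  have hsqrt : Real.sqrt (-s) = r := by rw [hs, neg_neg, Real.sqrt_sq hr.le]
  have hsN : s ∉ N := fun hsN' => hrN ⟨s, ⟨hsN', by rw [hs, mem_Iio]; nlinarith⟩, hsqrt⟩
  have hball : hPr.restrictSet (ball x (Real.sqrt (-s))) measurableSet_ball =
      hPr.restrictSet (ball x r) measurableSet_ball := by
    have : ∀ (ρ₁ ρ₂ : ℝ), ρ₁ = ρ₂ → hPr.restrictSet (ball x ρ₁) measurableSet_ball =
        hPr.restrictSet (ball x ρ₂) measurableSet_ball := by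
      intro ρ₁ ρ₂ h; subst h; rfl
    exact this _ _ hsqrt
  have hmass' : ((hPr.restrictSet (ball x (Real.sqrt (-s))) measurableSet_ball).boundary).mass < ⊤ := by
    rw [hball, ← heq]
    have hPr' : (P.isRepresentable_of_mass_ne_top hPm).restrictSet (closedBall x r)
        measurableSet_closedBall = hPr.restrictSet (closedBall x r) measurableSet_closedBall := rfl
    rw [← hPr']
    exact (hmass hr).2.trans_lt ENNReal.ofReal_lt_top
  have h := hN s hsN hmass'
  rwa [hball, ← heq] at h

end Polyhedral

end Literature.Geometry.GeometricMeasureTheory
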